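import Literature.NumberTheory.Sieve.MatomakiRadziwill
import HarnessLib

/-!
# Matomäki–Radziwiłł 2016: the interval systems of choice (4)

Topic `NumberTheory/Sieve`, companion of `MatomakiRadziwill.lean` (which defines
`SieveIntervalSystem η X`, the systems of intervals `[P_j, Q_j]` of §2 of the paper subject to the
spacing conditions (2), (3), and vendors Theorems 1, 3).  This file **constructs** the model
promised in the docstring of `SieveIntervalSystem`: the paper's example

> "given `0 < η < 1/6` choose any `[P_1, Q_1]` with `exp(√log X) ≥ Q_1 ≥ P_1 ≥ (log Q_1)^{40/η}`
> large enough, and choose the remaining `[P_j, Q_j]` as follows: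
> `P_j = exp(j^{4j} (log Q_1)^{j-1} log P_1)`, `Q_j = exp(j^{4j+2} (log Q_1)^j)`"  (§2, (4)),

with `η = 1/150` (the value used in §9), and **proves** that it satisfies (2) and (3)
(`notTooFar_choice`, `notTooClose_choice`), that `J` (the largest `j` with `Q_j ≤ exp(√log X)`)
exists and is `≤ √log X`, and the density sum `∑_{j ≤ J} log P_j / log Q_j ≤ (7/4) log P_1 / log Q_1`
(the paper's "`X log P_1/(j² log Q_1)`", summed with `∑ 1/j² ≤ 7/4`).  Everything is stated in the
logarithmic coordinates `L = log Q_1`, `p = log P_1`; the hypotheses of `SieveIntervalSystem.ofChoice`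
are `log L ≥ 1`, `30000 log L ≤ p ≤ L ≤ √log X` — the exponent `40/η = 6000` of the paper is
replaced by the more generous `30000`, which turns "large enough" into the explicit `log log Q_1 ≥ 1`
(only the order of magnitude of this exponent matters in §9: it becomes the constant `C'` of
Theorem 1).  Consumed by `MatomakiRadziwillTheorem1.lean` (Theorem 3 ⇒ Theorem 1, §9).

## References

* K. Matomäki, M. Radziwiłł, *Multiplicative functions in short intervals*, Ann. of Math. (2)
  183 (2016), 1015–1056 (doi:10.4007/annals.2016.183.3.6, arXiv:1501.04585): §2, conditions
  (2), (3), the example (4) and the definition of `J` (arXiv p. 6); §9 (choice `η = 1/150`).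

## Mathlib

Uses only `Real.exp/log`, `Nat.find`, `Finset` sums; `Real.log_two_lt_d9` for `10 log 2 < 7`.
-/

noncomputable section

open Finset Real

namespace Literature.NumberTheory.Sieve

namespace SieveIntervalSystem

/-! ### The choice (4) in logarithmic coordinates -/

/-- `log P_j = j^{4j} (log Q_1)^{j-1} log P_1` — the left endpoints of the choice (4) of
Matomäki–Radziwiłł, in terms of `L = log Q_1` and `p = log P_1` (valid for all `j ≥ 1`; at `j = 1`
it returns `p`). [cite: MatomakiRadziwillAnnals2016, §2 (4)] -/
def choiceLogP (L p : ℝ) (j : ℕ) : ℝ := (j : ℝ) ^ (4 * j) * L ^ (j - 1) * p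

/-- `log Q_j = j^{4j+2} (log Q_1)^j` — the right endpoints of the choice (4), in terms of
`L = log Q_1` (at `j = 1` it returns `L`). [cite: MatomakiRadziwillAnnals2016, §2 (4)] -/
def choiceLogQ (L : ℝ) (j : ℕ) : ℝ := (j : ℝ) ^ (4 * j + 2) * L ^ j

/-- `log P_1 = p`. [folklore] -/
@[simp] theorem choiceLogP_one (L p : ℝ) : choiceLogP L p 1 = p := by
  simp [choiceLogP]

/-- `log Q_1 = L`. [folklore] -/
@[simp] theorem choiceLogQ_one (L : ℝ) : choiceLogQ L 1 = L := by
  simp [choiceLogQ]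

/-- `j ≤ log Q_j` for `L ≥ 1`, `j ≥ 1` (so `Q_j → ∞`). [folklore] -/
theorem le_choiceLogQ {L : ℝ} (hL : 1 ≤ L) {j : ℕ} (hj : 1 ≤ j) : (j : ℝ) ≤ choiceLogQ L j := by
  unfold choiceLogQ
  have hj' : (1 : ℝ) ≤ j := by exact_mod_cast hj
  calc (j : ℝ) ≤ (j : ℝ) ^ (4 * j + 2) := le_self_pow₀ hj' (by omega)
    _ = (j : ℝ) ^ (4 * j + 2) * 1 := (mul_one _).symm
    _ ≤ (j : ℝ) ^ (4 * j + 2) * L ^ j :=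
        mul_le_mul_of_nonneg_left (one_le_pow₀ hL) (by positivity)

/-- `0 ≤ log Q_j` for `L ≥ 0`. [folklore] -/
theorem choiceLogQ_nonneg {L : ℝ} (hL : 0 ≤ L) (j : ℕ) : 0 ≤ choiceLogQ L j := by
  unfold choiceLogQ; positivity

/-- `log P_j ≤ log Q_j` when `0 ≤ p ≤ L` (`j ≥ 1`), i.e. `P_j ≤ Q_j`. [folklore] -/
theorem choiceLogP_le_choiceLogQ {L p : ℝ} (hp : 0 ≤ p) (hpL : p ≤ L) {j : ℕ} (hj : 1 ≤ j) :
    choiceLogP L p j ≤ choiceLogQ L j := by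
  unfold choiceLogP choiceLogQ
  have hL : 0 ≤ L := hp.trans hpL
  have hj' : (1 : ℝ) ≤ j := by exact_mod_cast hj
  obtain ⟨i, rfl⟩ : ∃ i, j = i + 1 := ⟨j - 1, by omega⟩
  simp only [Nat.add_sub_cancel]
  calc ((i + 1 : ℕ) : ℝ) ^ (4 * (i + 1)) * L ^ i * p
      ≤ ((i + 1 : ℕ) : ℝ) ^ (4 * (i + 1)) * L ^ i * L := by gcongr
    _ = ((i + 1 : ℕ) : ℝ) ^ (4 * (i + 1)) * 1 * L ^ (i + 1) := by ring
    _ ≤ ((i + 1 : ℕ) : ℝ) ^ (4 * (i + 1)) * ((i + 1 : ℕ) : ℝ) ^ 2 * L ^ (i + 1) := by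
        gcongr
        exact one_le_pow₀ hj'
    _ = ((i + 1 : ℕ) : ℝ) ^ (4 * (i + 1) + 2) * L ^ (i + 1) := by ring

/-- `log P_j / log Q_j = (p / L) / j²` (`L ≠ 0`, `j ≥ 1`). [folklore] -/
theorem choiceLogP_div_choiceLogQ {L : ℝ} (hL : L ≠ 0) (p : ℝ) {j : ℕ} (hj : 1 ≤ j) :
    choiceLogP L p j / choiceLogQ L j = p / L * (1 / (j : ℝ) ^ 2) := by
  unfold choiceLogP choiceLogQ
  have hj0 : (j : ℝ) ≠ 0 := by exact_mod_cast (show j ≠ 0 by omega)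
  obtain ⟨i, rfl⟩ : ∃ i, j = i + 1 := ⟨j - 1, by omega⟩
  simp only [Nat.add_sub_cancel]
  rw [pow_add, pow_succ L i]
  field_simp

/-- `∑_{j=1}^{n} 1/j² ≤ 7/4` (indeed `≤ 7/4 - 1/n` for `n ≥ 2`, as `1/j² ≤ 1/(j-1) - 1/j`). [folklore] -/
theorem sum_Icc_one_div_sq_le (n : ℕ) : ∑ j ∈ Icc 1 n, (1 : ℝ) / (j : ℝ) ^ 2 ≤ 7 / 4 := by
  suffices H : ∀ m : ℕ, ∑ j ∈ Icc 1 (m + 2), (1 : ℝ) / (j : ℝ) ^ 2 ≤ 7 / 4 - 1 / (m + 2 : ℝ) by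
    rcases Nat.lt_or_ge n 2 with hn | hn
    · interval_cases n <;> norm_num [Finset.sum_Icc_succ_top]
    · obtain ⟨m, rfl⟩ : ∃ m, n = m + 2 := ⟨n - 2, by omega⟩
      have := H m
      have h' : (0 : ℝ) < 1 / (m + 2 : ℝ) := by positivity
      linarith
  intro m
  induction m with
  | zero => norm_num [Finset.sum_Icc_succ_top]
  | succ m ih =>
    rw [show m + 1 + 2 = (m + 2) + 1 by ring, Finset.sum_Icc_succ_top (by omega)]
    have hm : (0 : ℝ) < (m + 2 : ℝ) := by positivity
    have key : (1 : ℝ) / ((m + 2 + 1 : ℕ) : ℝ) ^ 2 ≤ 1 / (m + 2 : ℝ) - 1 / (m + 1 + 2 : ℝ) := by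
      push_cast
      rw [div_sub_div _ _ hm.ne' (by positivity), div_le_div_iff₀ (by positivity) (by positivity)]
      ring_nf
      nlinarith
    push_cast at key ⊢
    linarith

/-- `∑_{j=1}^{n} log P_j / log Q_j ≤ (7/4) p / L` for the choice (4) (`0 ≤ p`, `0 < L`): the
paper's "`∑_j log P_j / log Q_j = (log P_1 / log Q_1) ∑_j 1/j²`".
[cite: MatomakiRadziwillAnnals2016, §2 (sieve density of `𝒮` under (4))] -/
theorem sum_choiceLogP_div_choiceLogQ_le {L p : ℝ} (hL : 0 < L) (hp : 0 ≤ p) (n : ℕ) :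
    ∑ j ∈ Icc 1 n, choiceLogP L p j / choiceLogQ L j ≤ 7 / 4 * (p / L) := by
  calc ∑ j ∈ Icc 1 n, choiceLogP L p j / choiceLogQ L j
      = ∑ j ∈ Icc 1 n, p / L * (1 / (j : ℝ) ^ 2) :=
        Finset.sum_congr rfl fun j hj => choiceLogP_div_choiceLogQ hL.ne' p (Finset.mem_Icc.mp hj).1
    _ = p / L * ∑ j ∈ Icc 1 n, 1 / (j : ℝ) ^ 2 := (Finset.mul_sum _ _ _).symm
    _ ≤ p / L * (7 / 4) := mul_le_mul_of_nonneg_left (sum_Icc_one_div_sq_le n) (by positivity)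
    _ = 7 / 4 * (p / L) := mul_comm _ _

/-! ### Conditions (2) and (3) for the choice (4) -/

/-- **Condition (3)** ("not too close") for the choice (4): for `L ≥ 1`, `p ≥ 3600` and `j ≥ 2`,
`8 log Q_{j-1} + 16 log j ≤ (η/j²) log P_j` with `η = 1/150`. Proof:
`log Q_{j-1} = (j-1)^{4j-2} L^{j-1} ≤ j^{4j-2} L^{j-1}`, `16 log j ≤ 16 j^{4j-2} L^{j-1}`, while
`(η/j²) log P_j = η p · j^{4j-2} L^{j-1}` and `η p ≥ 24`.
[cite: MatomakiRadziwillAnnals2016, §2 (3)–(4)] -/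
theorem notTooClose_choice {L p : ℝ} (hL : 1 ≤ L) (hp : 3600 ≤ p) {j : ℕ} (hj : 2 ≤ j) :
    8 * choiceLogQ L (j - 1) + 16 * Real.log j ≤ (1 / 150) / (j : ℝ) ^ 2 * choiceLogP L p j := by
  obtain ⟨k, rfl⟩ : ∃ k, j = k + 2 := ⟨j - 2, by omega⟩
  unfold choiceLogQ choiceLogP
  simp only [show k + 2 - 1 = k + 1 by omega]
  rw [show 4 * (k + 1) + 2 = 4 * k + 6 by ring, show 4 * (k + 2) = (4 * k + 6) + 2 by ring,
    show ((k + 2 : ℕ) : ℝ) ^ ((4 * k + 6) + 2) = ((k + 2 : ℕ) : ℝ) ^ (4 * k + 6) * ((k + 2 : ℕ) : ℝ) ^ 2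
      from pow_add _ _ _]
  set A : ℝ := ((k + 2 : ℕ) : ℝ) ^ (4 * k + 6) * L ^ (k + 1) with hA
  have hk2 : (2 : ℝ) ≤ ((k + 2 : ℕ) : ℝ) := by exact_mod_cast (by omega : 2 ≤ k + 2)
  have hk1 : (1 : ℝ) ≤ ((k + 2 : ℕ) : ℝ) := by linarith
  have hLk : (1 : ℝ) ≤ L ^ (k + 1) := one_le_pow₀ hL
  have hA1 : ((k + 2 : ℕ) : ℝ) ≤ A := by
    calc ((k + 2 : ℕ) : ℝ) ≤ ((k + 2 : ℕ) : ℝ) ^ (4 * k + 6) := le_self_pow₀ hk1 (by omega)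
      _ = ((k + 2 : ℕ) : ℝ) ^ (4 * k + 6) * 1 := (mul_one _).symm
      _ ≤ A := by rw [hA]; gcongr
  have hApos : 0 ≤ A := by positivity
  -- `log Q_{j-1} ≤ A`
  have h1 : ((k + 1 : ℕ) : ℝ) ^ (4 * k + 6) * L ^ (k + 1) ≤ A := by
    rw [hA]
    refine mul_le_mul_of_nonneg_right ?_ (by positivity)
    exact pow_le_pow_left₀ (by positivity) (by exact_mod_cast (by omega : k + 1 ≤ k + 2)) _
  -- `log j ≤ j ≤ A`
  have h2 : Real.log ((k + 2 : ℕ) : ℝ) ≤ A :=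
    (Real.log_le_self (by positivity)).trans hA1
  -- the right-hand side is `A p / 150`
  have h3 : (1 / 150) / ((k + 2 : ℕ) : ℝ) ^ 2 *
      (((k + 2 : ℕ) : ℝ) ^ (4 * k + 6) * ((k + 2 : ℕ) : ℝ) ^ 2 * L ^ (k + 1) * p) = A * p / 150 := by
    rw [hA]
    field_simp
  rw [h3]
  nlinarith

/-- `(k+1)^{4(k+1)} ≥ (k+2)^4` for `k ≥ 1` (i.e. `(j-1)^{4j-4} ≥ j^4` for `j ≥ 3`). [folklore] -/
theorem pow_four_le_pow {k : ℕ} (hk : 1 ≤ k) :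
    ((k + 2 : ℕ) : ℝ) ^ 4 ≤ ((k + 1 : ℕ) : ℝ) ^ (4 * (k + 1)) := by
  have h1 : ((k + 2 : ℕ) : ℝ) ≤ ((k + 1 : ℕ) : ℝ) ^ 2 := by
    have : (k + 2 : ℕ) ≤ (k + 1) ^ 2 := by nlinarith
    exact_mod_cast this
  have hk1 : (1 : ℝ) ≤ ((k + 1 : ℕ) : ℝ) := by exact_mod_cast (by omega : 1 ≤ k + 1)
  calc ((k + 2 : ℕ) : ℝ) ^ 4 ≤ (((k + 1 : ℕ) : ℝ) ^ 2) ^ 4 := by gcongr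
    _ = ((k + 1 : ℕ) : ℝ) ^ 8 := by ring
    _ ≤ ((k + 1 : ℕ) : ℝ) ^ (4 * (k + 1)) := pow_le_pow_right₀ hk1 (by omega)

/-- **Condition (2)** ("not too far") for the choice (4): for `log L ≥ 1` (`L ≥ 1`),
`p ≥ 30000 log L` and `j ≥ 2`, `log log Q_j ≤ (η/(4j²)) (log P_{j-1} - 1)` with `η = 1/150`.
Proof: `log log Q_j = (4j+2) log j + j log L`; for `j = 2` this is `10 log 2 + 2 log L ≤ (p-1)/2400`;
for `j ≥ 3`, `log P_{j-1} = (j-1)^{4j-4} L^{j-2} p ≥ j^4 · 30000 log L` while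
`log log Q_j ≤ 5 j² log L`.  (The paper asks `P_1 ≥ (log Q_1)^{40/η}` "large enough"; the exponent
`30000 ≥ 40/η = 6000` makes "large enough" the explicit `log log Q_1 ≥ 1`.)
[cite: MatomakiRadziwillAnnals2016, §2 (2), (4)] -/
theorem notTooFar_choice {L p : ℝ} (hL1 : 1 ≤ L) (hL : 1 ≤ Real.log L) (hp : 30000 * Real.log L ≤ p)
    {j : ℕ} (hj : 2 ≤ j) :
    Real.log (choiceLogQ L j) ≤ (1 / 150) / (4 * (j : ℝ) ^ 2) * (choiceLogP L p (j - 1) - 1) := by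
  obtain ⟨k, rfl⟩ : ∃ k, j = k + 2 := ⟨j - 2, by omega⟩
  unfold choiceLogQ choiceLogP
  simp only [show k + 2 - 1 = k + 1 by omega, Nat.add_sub_cancel]
  set ℓ := Real.log L with hℓ
  have hL0 : 0 < L := by linarith
  have hk0 : (0 : ℝ) < ((k + 2 : ℕ) : ℝ) := by positivity
  have hlogQ : Real.log (((k + 2 : ℕ) : ℝ) ^ (4 * (k + 2) + 2) * L ^ (k + 2)) =
      (4 * (k + 2) + 2 : ℕ) * Real.log ((k + 2 : ℕ) : ℝ) + ((k + 2 : ℕ) : ℝ) * ℓ := by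
    rw [Real.log_mul (by positivity) (by positivity), Real.log_pow, Real.log_pow, hℓ]
  rw [hlogQ]
  rcases Nat.eq_zero_or_pos k with rfl | hk
  · -- `j = 2`: `10 log 2 + 2 log L ≤ (p - 1)/2400`
    norm_num
    have h2 : Real.log 2 < 0.6931471808 := Real.log_two_lt_d9
    nlinarith
  · -- `j ≥ 3`
    have hk1 : 1 ≤ k := hk
    have hpow := pow_four_le_pow hk1
    have hLk : (1 : ℝ) ≤ L ^ k := one_le_pow₀ hL1
    have hlogj : Real.log ((k + 2 : ℕ) : ℝ) ≤ ((k + 2 : ℕ) : ℝ) := Real.log_le_self (by positivity)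
    have hlogj0 : 0 ≤ Real.log ((k + 2 : ℕ) : ℝ) := Real.log_nonneg (by exact_mod_cast (by omega : 1 ≤ k + 2))
    -- lower bound for `log P_{j-1}`
    have hP : ((k + 2 : ℕ) : ℝ) ^ 4 * (30000 * ℓ) ≤
        ((k + 1 : ℕ) : ℝ) ^ (4 * (k + 1)) * L ^ k * p := by
      calc ((k + 2 : ℕ) : ℝ) ^ 4 * (30000 * ℓ)
          ≤ ((k + 1 : ℕ) : ℝ) ^ (4 * (k + 1)) * (30000 * ℓ) := by gcongr
        _ = ((k + 1 : ℕ) : ℝ) ^ (4 * (k + 1)) * 1 * (30000 * ℓ) := by ring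
        _ ≤ ((k + 1 : ℕ) : ℝ) ^ (4 * (k + 1)) * L ^ k * p := by gcongr
    -- upper bound for `log log Q_j`
    set m : ℝ := ((k + 2 : ℕ) : ℝ) with hm
    have hm3 : (3 : ℝ) ≤ m := by rw [hm]; exact_mod_cast (by omega : 3 ≤ k + 2)
    have hcast : ((4 * (k + 2) + 2 : ℕ) : ℝ) = 4 * m + 2 := by rw [hm]; push_cast; ring
    rw [hcast]
    have hℓ0 : 0 ≤ ℓ := zero_le_one.trans hL
    have hU : (4 * m + 2) * Real.log m + m * ℓ ≤ 5 * m ^ 2 * ℓ := by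
      have h1 : (4 * m + 2) * Real.log m ≤ (4 * m + 2) * m * ℓ := by
        calc (4 * m + 2) * Real.log m ≤ (4 * m + 2) * m := by
              exact mul_le_mul_of_nonneg_left hlogj (by linarith)
          _ = (4 * m + 2) * m * 1 := (mul_one _).symm
          _ ≤ (4 * m + 2) * m * ℓ := by gcongr
      have h2 : 0 ≤ (m - 3) * m * ℓ := mul_nonneg (mul_nonneg (by linarith) hk0.le) hℓ0
      nlinarith
    -- compare
    have hden : (0 : ℝ) < 4 * m ^ 2 := by positivity
    rw [div_mul_eq_mul_div, le_div_iff₀ hden]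
    have e1 : ((4 * m + 2) * Real.log m + m * ℓ) * (4 * m ^ 2) ≤ 20 * (m ^ 4 * ℓ) :=
      calc ((4 * m + 2) * Real.log m + m * ℓ) * (4 * m ^ 2) ≤ 5 * m ^ 2 * ℓ * (4 * m ^ 2) :=
            mul_le_mul_of_nonneg_right hU hden.le
        _ = 20 * (m ^ 4 * ℓ) := by ring
    have e2 : (1 : ℝ) ≤ m ^ 4 * ℓ := by
      have : (1 : ℝ) ≤ m ^ 4 := one_le_pow₀ (by linarith)
      nlinarith
    have e3 : 30000 * (m ^ 4 * ℓ) ≤ ((k + 1 : ℕ) : ℝ) ^ (4 * (k + 1)) * L ^ k * p := by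
      linarith [hP]
    linarith

/-! ### The number `J` of intervals -/

/-- Some `Q_{m+2}` exceeds any given bound (`L ≥ 1`). [folklore] -/
theorem exists_lt_choiceLogQ {L : ℝ} (hL : 1 ≤ L) (E : ℝ) : ∃ m : ℕ, E < choiceLogQ L (m + 2) := by
  refine ⟨⌈E⌉₊, ?_⟩
  calc E ≤ ⌈E⌉₊ := Nat.le_ceil E
    _ < ((⌈E⌉₊ + 2 : ℕ) : ℝ) := by push_cast; linarith
    _ ≤ choiceLogQ L (⌈E⌉₊ + 2) := le_choiceLogQ hL (by omega)

open Classical in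
/-- `J`, the largest index `j ≥ 1` with `log Q_j ≤ E` (for `L = log Q_1 ≤ E`; in the paper
`E = √log X`). [cite: MatomakiRadziwillAnnals2016, §2] -/
def choiceJ (L E : ℝ) (hL : 1 ≤ L) : ℕ := Nat.find (exists_lt_choiceLogQ hL E) + 1

/-- `1 ≤ J`. [folklore] -/
theorem one_le_choiceJ {L E : ℝ} (hL : 1 ≤ L) : 1 ≤ choiceJ L E hL := Nat.le_add_left 1 _

open Classical in
/-- `log Q_J ≤ E` (given `log Q_1 = L ≤ E`). [folklore] -/
theorem choiceLogQ_choiceJ_le {L E : ℝ} (hL : 1 ≤ L) (hLE : L ≤ E) :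
    choiceLogQ L (choiceJ L E hL) ≤ E := by
  unfold choiceJ
  rcases h : Nat.find (exists_lt_choiceLogQ hL E) with _ | m
  · simpa using hLE
  · have hm : ¬ (E < choiceLogQ L (m + 2)) := Nat.find_min _ (by rw [h]; exact Nat.lt_succ_self m)
    rw [not_lt] at hm
    exact hm

open Classical in
/-- `E < log Q_{J+1}`. [folklore] -/
theorem lt_choiceLogQ_choiceJ_succ {L E : ℝ} (hL : 1 ≤ L) :
    E < choiceLogQ L (choiceJ L E hL + 1) := by
  unfold choiceJ
  exact Nat.find_spec (exists_lt_choiceLogQ hL E)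

/-- `J ≤ E` (crudely: `J ≤ log Q_J ≤ E`). [folklore] -/
theorem choiceJ_le {L E : ℝ} (hL : 1 ≤ L) (hLE : L ≤ E) : (choiceJ L E hL : ℝ) ≤ E :=
  (le_choiceLogQ hL (one_le_choiceJ hL)).trans (choiceLogQ_choiceJ_le hL hLE)

/-! ### The interval system -/

/-- **The interval system of choice (4)** at level `X` with `η = 1/150`, built from
`L = log Q_1` and `p = log P_1` subject to `log L ≥ 1`, `30000 log L ≤ p ≤ L ≤ √log X`:
`P_j = exp(j^{4j} L^{j-1} p)`, `Q_j = exp(j^{4j+2} L^j)`, `J` the largest `j` with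
`Q_j ≤ exp(√log X)`.  This is the paper's example "given `0 < η < 1/6` choose any `[P_1, Q_1]`
with `exp(√log X) ≥ Q_1 ≥ P_1 ≥ (log Q_1)^{40/η}` large enough, and choose the remaining
`[P_j, Q_j]` as follows: `P_j = exp(j^{4j} (log Q_1)^{j-1} log P_1)`, `Q_j = exp(j^{4j+2} (log Q_1)^j)`"
(with the exponent `40/η = 6000` replaced by `30000`, which makes "large enough" the explicit
`log log Q_1 ≥ 1`), used in §9 with `η = 1/150`.
[cite: MatomakiRadziwillAnnals2016, §2 (4) and §9 (proof of Theorem 1)] -/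
def ofChoice (X L p : ℝ) (hL : 1 ≤ Real.log L) (hp : 30000 * Real.log L ≤ p) (hpL : p ≤ L)
    (hLX : L ≤ Real.sqrt (Real.log X)) : SieveIntervalSystem (1 / 150) X :=
  have hL1 : 1 ≤ L := by linarith
  { P := fun j => Real.exp (choiceLogP L p j)
    Q := fun j => Real.exp (choiceLogQ L j)
    J := choiceJ L (Real.sqrt (Real.log X)) hL1
    pos_P := fun j _ => Real.exp_pos _
    one_le_P_one := by
      simp only [choiceLogP_one]
      exact Real.one_le_exp (by linarith)
    P_le_Q := fun j hj => Real.exp_le_exp.mpr (choiceLogP_le_choiceLogQ (by linarith) hpL hj)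
    notTooFar := fun j hj => by
      rw [Real.log_exp, Real.log_exp]
      exact notTooFar_choice hL1 hL hp hj
    notTooClose := fun j hj => by
      rw [Real.log_exp, Real.log_exp]
      exact notTooClose_choice hL1 (by linarith) hj
    one_le_J := one_le_choiceJ hL1
    Q_J_le := Real.exp_le_exp.mpr (choiceLogQ_choiceJ_le hL1 hLX)
    lt_Q_succ := Real.exp_lt_exp.mpr (lt_choiceLogQ_choiceJ_succ hL1) }

section ofChoice

variable {X L p : ℝ} (hL : 1 ≤ Real.log L) (hp : 30000 * Real.log L ≤ p) (hpL : p ≤ L)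
  (hLX : L ≤ Real.sqrt (Real.log X))

/-- The left endpoints of `ofChoice`. [folklore] -/
@[simp] theorem ofChoice_P (j : ℕ) : (ofChoice X L p hL hp hpL hLX).P j = Real.exp (choiceLogP L p j) :=
  rfl

/-- The right endpoints of `ofChoice`. [folklore] -/
@[simp] theorem ofChoice_Q (j : ℕ) : (ofChoice X L p hL hp hpL hLX).Q j = Real.exp (choiceLogQ L j) :=
  rfl

/-- `P_1 = e^p`. [folklore] -/
theorem ofChoice_P_one : (ofChoice X L p hL hp hpL hLX).P 1 = Real.exp p := by simp

/-- `Q_1 = e^L`. [folklore] -/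
theorem ofChoice_Q_one : (ofChoice X L p hL hp hpL hLX).Q 1 = Real.exp L := by simp

/-- `J ≤ √log X`. [folklore] -/
theorem ofChoice_J_le : ((ofChoice X L p hL hp hpL hLX).J : ℝ) ≤ Real.sqrt (Real.log X) :=
  choiceJ_le (hL := by linarith) hLX

/-- `1 ≤ J`. [folklore] -/
theorem ofChoice_one_le_J : 1 ≤ (ofChoice X L p hL hp hpL hLX).J := one_le_choiceJ (by linarith)

/-- **Sieve density of the choice (4)**: `∑_{j ≤ J} log P_j / log Q_j ≤ (7/4) · p / L`
(the paper: "`X log P_j / log Q_j`, which with the choice (4) is `X log P_1 / (j² log Q_1)`").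
[cite: MatomakiRadziwillAnnals2016, §2] -/
theorem ofChoice_sum_log_div_log_le :
    ∑ j ∈ Icc 1 (ofChoice X L p hL hp hpL hLX).J,
        Real.log ((ofChoice X L p hL hp hpL hLX).P j) / Real.log ((ofChoice X L p hL hp hpL hLX).Q j)
      ≤ 7 / 4 * (p / L) := by
  simp only [ofChoice_P, ofChoice_Q, Real.log_exp]
  have hL0 : 0 < L := by linarith
  have hp0 : 0 ≤ p := by
    have : 0 ≤ Real.log L := by linarith
    nlinarith
  exact sum_choiceLogP_div_choiceLogQ_le hL0 hp0 _

end ofChoice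

end SieveIntervalSystem

end Literature.NumberTheory.Sieve
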